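import Summits.ResolutionOfSingularities.ResolutionOfSingularities.Theorems.MarkedTransferCampaignW46TypedProcedureAnchors
import HarnessLib

/-!
# [OURS · L1 W4.6, rung (ii) companion] The typed Th. 16.6 procedure in the FORCED regime: the centre rule
# is deterministic — it blows up the singular point — pure-logic anchors over
# `Theorems/MarkedTransferCampaignW46TypedProcedure.lean` (cell res-hironaka, LADDER-RESOLUTION rung L, D-0089;
# slot W4.6, seat res-L1-s46-pv-4; host route MarkedTransfer, `--supports stmt-ResolutionOfSingularities-16156`)

HONEST FRAMING. Nothing here is a statement of H. Hironaka's manuscript (2017-03-23, [Hironaka2017]) and nothing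
here asserts that any statement of it holds. These are THEOREMS OF PURE LOGIC about the OURS definitions
`CampaignW46.IsCentre`, `Step`, `Run`, `Terminates` of the typed-procedure module (res-L1-type-o1) and the typed
CANDIDATE carriers under them (row 001 `IdealExponent.sing`, `IsPermissibleCentre`; the résumé's Def. 15.12
inclusion hypotheses enter through the landed anchor `IsCentre.isPermissibleCentre`). AI review is weaker than
expert review. No `sorry`; axioms standard.

## Why this file (the bridge sentence of rung (ii) at `p = 2`, seat res-L1-s46-pv-4)

The W4.6 rungs are statements about the TYPED procedure (`CampaignW46.Run` / `Terminates`), whose centre rule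
(Th. 16.6 p.84 l.4–6, literal reading `IsCentre`: `D ⊆ ∇(E)` closed irreducible smooth) leaves the centre to be
CHOSEN inside the terminal plat. In the FORCED regime — the current ideal exponent has at most one singular
point, `E.sing.Subsingleton` — there is nothing to choose: every admitted centre IS `Sing(E)`, a single closed
point (`IsCentre.coe_eq_sing_of_subsingleton`, `Run.centre_eq_sing`), and every stage of a run is singular
(`Run.sing_nonempty`). So in that regime the typed procedure is the iteration of POINT blow-ups at the singular
point — for a hypersurface `z^p = a(u₁,…,uₙ)` exactly the dynamics that route `WildCones` types coefficient-wise
and for which `Theorems/WildConesCampaignW46ThreefoldsCharTwo.lean` proves Milnor descent at `p = 2` (the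
scheme-level dictionary between `Step.blowup` and that coefficient calculus is NOT in this file and is not
claimed). Also recorded: a run never visits a resolved state (`Run.sing_ne_empty`, `terminates_resolved`) — the
typed «the procedure stops because `Sing` became empty» shows as «no résumé-admitted step exists», cf. the
(VAC)/`Terminates` remarks of the typed-procedure module.

## References

* `Theorems/MarkedTransferCampaignW46TypedProcedure.lean` (module docstring, DESIGN POINTS (CTR)/(REG)/(VAC)) and its
  Anchors companion; plan/SIZED-ASK-L.md v0.2 §S S-s46; H. Hironaka, ms. 2017-03-23, Th. 16.6 p.84 l.4–8, Def. 15.12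
  p.80 l.37 – p.81 l.2, §2.1 p.4 l.37–39 — scope only, under adjudication, not cited as fact. [Hironaka2017]
-/

noncomputable section

set_option linter.dupNamespace false -- mandated namespace of this single-conjunct summit

open CategoryTheory AlgebraicGeometry TopologicalSpace

namespace Summit.ResolutionOfSingularities.ResolutionOfSingularities.Theorems

namespace CampaignW46

open Literature.AlgebraicGeometry.Resolution
open Literature.AlgebraicGeometry.Hironaka2017.S02Preliminaries
open Literature.AlgebraicGeometry.Hironaka2017.Datum
open Literature.AlgebraicGeometry.Hironaka2017.S15ARSchemes
open Literature.AlgebraicGeometry.Hironaka2017.S16Proof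

universe u

variable {n : ℕ} {p : ℕ} [Fact p.Prime] {K : Type u} [Field K] [CharP K p]

section Centre

variable {N : Notions.{u} n} {A : AmbientDatum p K} {E : IdealExponent A.Z} {R : Resume N A E}
  {D : Closeds A.Z}

/-- Pure logic: a centre admitted by the typed rule lies in `Sing(E)` (row 001 `IdealExponent.sing`), through the
résumé's Def. 15.12 inclusions (anchor `IsCentre.isPermissibleCentre`). [folklore] -/
theorem IsCentre.subset_sing (h : IsCentre R D) : (D : Set A.Z) ⊆ E.sing :=
  h.isPermissibleCentre.subset_sing

/-- Pure logic: an admitted centre is non-empty («irreducible»). [folklore] -/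
theorem IsCentre.coe_nonempty (h : IsCentre R D) : (D : Set A.Z).Nonempty :=
  h.irreducible.nonempty

/-- Pure logic: if the typed rule admits a centre at all, the current ideal exponent is singular somewhere —
`Sing(E) ≠ ∅`. [folklore] -/
theorem IsCentre.sing_nonempty (h : IsCentre R D) : E.sing.Nonempty :=
  h.coe_nonempty.mono h.subset_sing

/-- [OURS · L1 W4.6 rung (ii) companion; NOT a statement of the manuscript] **The centre rule is deterministic in
the forced regime**: if `Sing(E)` has at most one point then every centre admitted by the typed Th. 16.6 rule IS
`Sing(E)` (as a set) — the procedure must blow up the singular point. [folklore] -/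
theorem IsCentre.coe_eq_sing_of_subsingleton (h : IsCentre R D) (hS : E.sing.Subsingleton) :
    (D : Set A.Z) = E.sing := by
  refine h.subset_sing.antisymm fun x hx => ?_
  obtain ⟨y, hy⟩ := h.coe_nonempty
  have hxy : x = y := hS hx (h.subset_sing hy)
  rw [hxy]
  exact hy

/-- [OURS · L1 W4.6 rung (ii) companion; NOT a statement of the manuscript] The same with the point named: in the
forced regime there is a point `ξ` with `D = {ξ} = Sing(E)`. [folklore] -/
theorem IsCentre.exists_coe_eq_singleton (h : IsCentre R D) (hS : E.sing.Subsingleton) :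
    ∃ ξ : A.Z, (D : Set A.Z) = {ξ} ∧ E.sing = {ξ} := by
  obtain ⟨ξ, hξ⟩ := h.coe_nonempty
  have hD : (D : Set A.Z) = {ξ} :=
    (Set.subsingleton_iff_singleton hξ).mp (hS.anti h.subset_sing)
  exact ⟨ξ, hD, (h.coe_eq_sing_of_subsingleton hS).symm.trans hD⟩

end Centre

section Runs

variable {N : Notions.{u} n} {Rd : Reading p K N}

/-- Pure logic: every stage of a run of the typed procedure is singular (`Sing(E_k) ≠ ∅`) — a step needs an
admitted centre, which lies in `Sing(E_k)`. [folklore] -/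
theorem Run.sing_nonempty (r : Run N Rd) (k : ℕ) : (r.E k).sing.Nonempty :=
  (r.step k).centre.sing_nonempty

/-- Pure logic: a run never visits a resolved state. [folklore] -/
theorem Run.sing_ne_empty (r : Run N Rd) (k : ℕ) : (r.E k).sing ≠ ∅ :=
  (r.sing_nonempty k).ne_empty

/-- [OURS · L1 W4.6 rung (ii) companion; NOT a statement of the manuscript] **In the forced regime a run of the
typed procedure is a sequence of point blow-ups at the singular points**: if at every stage `Sing(E_k)` has at
most one point, then at every stage the centre of the step IS `Sing(E_k)`. [folklore] -/
theorem Run.centre_eq_sing (r : Run N Rd) (hS : ∀ k, (r.E k).sing.Subsingleton) (k : ℕ) :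
    ((r.step k).D : Set (r.A k).Z) = (r.E k).sing :=
  (r.step k).centre.coe_eq_sing_of_subsingleton (hS k)

/-- [OURS · L1 W4.6 rung (ii) companion; NOT a statement of the manuscript] The same with the points named: a run
in the forced regime carries a sequence of closed points `ξ k` with `D_k = {ξ k} = Sing(E_k)`. [folklore] -/
theorem Run.exists_centres_eq_singleton (r : Run N Rd) (hS : ∀ k, (r.E k).sing.Subsingleton) :
    ∃ ξ : ∀ k, (r.A k).Z, ∀ k, ((r.step k).D : Set (r.A k).Z) = {ξ k} ∧ (r.E k).sing = {ξ k} := by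
  choose ξ hξ using fun k => (r.step k).centre.exists_coe_eq_singleton (hS k)
  exact ⟨ξ, hξ⟩

/-- Pure logic (sanity of the shape `Terminates`): the typed procedure «terminates» in the regime of RESOLVED states
— no run has even one resolved stage. (This is how «the procedure stops because `Sing` became empty» reads in the
typed vocabulary: no admitted step exists from a resolved state.) [folklore] -/
theorem terminates_resolved (N : Notions.{u} n) (Rd : Reading p K N) :
    Terminates N Rd (fun _ E => E.sing = ∅) :=
  fun r hr => r.sing_ne_empty 0 (hr 0)

/-- Pure logic: more generally, a regime that forces `Sing(E) = ∅` at some stage of every run in it is terminating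
— the form in which a rung whose invariant reaches a resolved state within the regime concludes. [folklore] -/
theorem terminates_of_forall_run_exists_resolved (N : Notions.{u} n) (Rd : Reading p K N) (Rg : Regime p K)
    (h : ∀ r : Run N Rd, (∀ k, Rg (r.A k) (r.E k)) → ∃ k, (r.E k).sing = ∅) : Terminates N Rd Rg :=
  fun r hr => by
    obtain ⟨k, hk⟩ := h r hr
    exact r.sing_ne_empty k hk

end Runs

end CampaignW46

end Summit.ResolutionOfSingularities.ResolutionOfSingularities.Theorems

end
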